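import Literature.Barriers.Schanuel.AlgebraicIndependenceOfLogarithmsStructuralRankProofs
import Literature.Barriers.Schanuel.LinearSubgroupMethodLimitWaldschmidtProofs
import Literature.NumberTheory.Transcendental.SixExponentialsSeveralVariablesDischargeProofs
import HarnessLib

/-!
# Barrier (Schanuel): `s ≤ 2r` unconditionally — discharge of `roy1995_structuralRank_le_two_mul_rank`

Third file on Roy's structural rank, after
`Literature/Barriers/Schanuel/AlgebraicIndependenceOfLogarithms.lean` (the named fact
`Literature.Barriers.Schanuel.roy1995_structuralRank_le_two_mul_rank`: for every `d × l` matrix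
`M` with entries in `𝓛`, the `ℚ`-span of the logarithms of algebraic numbers,
`s_str(M) ≤ 2 · rank M` [Roy1995, §1 Corollary 1.3 and Remark (i) p. 54]) and
`Literature/Barriers/Schanuel/AlgebraicIndependenceOfLogarithmsStructuralRankProofs.lean` (the
complete printed deduction of that fact from Roy's Theorem 1.2 = Waldschmidt's linear subgroup
theorem for matrices of logarithms, `roy1995_structuralRank_le_two_mul_rank_of_linearSubgroup`).
This file closes the fact: **`roy1995_structuralRank_le_two_mul_rank_holds`**, an unconditional,
sorry-free theorem (axioms `propext`, `Classical.choice`, `Quot.sound`).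

## The chain (every link is a theorem of the tree)

1. **Waldschmidt 1981, Théorème 2.1** [Waldschmidt1981, §2 p. 100] — the transcendence input
   (Schneider's method in several variables): the tree's
   `Literature.NumberTheory.Transcendental.Waldschmidt1981.thm_2_1_holds`
   (`Literature/NumberTheory/Transcendental/SixExponentialsSeveralVariablesDischargeProofs.lean`),
   proved there bottom-up along the paper — the auxiliary polynomials of Corollaire 3.2,
   Liouville's inequality, a weak form of Théorème 4.1 (Masser's zero estimate, obtained in the
   tree from Philippon's zero estimate on `𝔾ₐ × 𝔾ₘ^d` [Philippon1986, Thm 2.1]), Corollaire 4.2,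
   Lemme 5.1, Proposition 6.1, Théorème 1.1, and §6 c) for Théorème 2.1; see that module's
   docstring for the one deviation from the printed route (the constant in Théorème 4.1).
2. **Roy 1995, Theorem 1.2** [Roy1995, §1 p. 52], Roy's quotation of Théorème 2.1 (`GL(ℚ)` bases,
   `d₁/r₁ ≥ d/r`, entries in `𝓛`): the tree's named fact
   `Literature.Barriers.Schanuel.waldschmidt1981_linearSubgroup_matrix`, which follows from
   Théorème 2.1 by `waldschmidt1981_linearSubgroup_matrix_of_thm_2_1`
   (`Literature/Barriers/Schanuel/LinearSubgroupMethodLimitWaldschmidtProofs.lean`); the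
   composition of the two is used below through the local lemma `linearSubgroup_input` (it is
   also recorded in the tree as `waldschmidt1981_linearSubgroup_matrix_holds`,
   `Literature/Barriers/Schanuel/LinearSubgroupMethodLimitHolds.lean`).
3. **Roy 1995, Corollary 1.3 (`T`-part) and Remark (i)** [Roy1995, §1 pp. 52–54]: Theorem 1.2
   ⟹ every `M ∈ M_{d,l}(𝓛)` lies in a subspace `T` of `M_{d,l}` defined over `ℚ` with
   `T ⊆ M_{d,l}(2r)`, hence `s ≤ 2r` — the tree's
   `exists_isDefinedOverRat_two_mul_rank_of_linearSubgroup` and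
   `roy1995_structuralRank_le_two_mul_rank_of_linearSubgroup`
   (`AlgebraicIndependenceOfLogarithmsStructuralRankProofs.lean`, strong induction on `d + l` as
   printed on p. 53).

## Contents

* `exists_isDefinedOverRat_two_mul_rank` — Corollary 1.3, `T`-part, unconditionally (links 1–3).
* `structuralRank_le_two_mul_rank`, `roy1995_structuralRank_le_two_mul_rank_holds` — `s ≤ 2r`
  and the discharge of the named fact; `rank_le_structuralRank_and_le_two_mul_rank` — the printed
  `r ≤ s ≤ 2r` [Roy1995, §1 Remark (i)]; `structuralRank_le_two_mul_rank_of_isAlgebraic_cexp` —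
  the same for matrices whose entries are themselves logarithms of algebraic numbers.

What is NOT here: the `S`-part of Corollary 1.3 (`S ⊆ T ∩ M_{d,l}(r)`, `dim S ≥ dim T − 2r²`),
which the structural rank does not use; the conjectured equality `r = s` is
`algIndepLogarithms_predicts_rank_eq_structuralRank` (proved from `AlgIndepLogarithms` in
`AlgebraicIndependenceOfLogarithmsRankProofs.lean`) and is open unconditionally.

## References

* [Roy1995] D. Roy, *Points whose coordinates are logarithms of algebraic numbers on algebraic
  varieties*, Acta Math. 175 (1995) 49–73: §1 Theorem 1.2 (p. 52), Corollary 1.3 and its proof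
  (pp. 52–53), Remark (i) (p. 54).
* [Waldschmidt1981] M. Waldschmidt, *Transcendance et exponentielles en plusieurs variables*,
  Invent. Math. 63 (1981) 97–127: §2 Théorème 2.1 (p. 100).
* [Philippon1986] P. Philippon, *Lemmes de zéros dans les groupes algébriques commutatifs*,
  Bull. Soc. Math. France 114 (1986) 355–383: Théorème 2.1 (the zero estimate used by the tree's
  proof of Théorème 2.1 in place of Masser's).
-/

noncomputable section

open Complex

namespace Literature.Barriers.Schanuel

variable {d l : ℕ}

/-- Roy's Theorem 1.2 (the named fact `waldschmidt1981_linearSubgroup_matrix`) holds: Waldschmidt's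
Théorème 2.1 is proved in the tree (`Waldschmidt1981.thm_2_1_holds`) and implies Roy's quotation
(`waldschmidt1981_linearSubgroup_matrix_of_thm_2_1`). Local copy of the composition (the tree's
`waldschmidt1981_linearSubgroup_matrix_holds`), kept private to this file.
[cite: Roy1995, §1 Theorem 1.2 (p. 52), quoting Waldschmidt1981 Théorème 2.1 (p. 100)] -/
private theorem linearSubgroup_input : waldschmidt1981_linearSubgroup_matrix :=
  waldschmidt1981_linearSubgroup_matrix_of_thm_2_1
    Literature.NumberTheory.Transcendental.Waldschmidt1981.thm_2_1_holds

/-- **Roy 1995, Corollary 1.3 (`T`-part), unconditionally**: every `d × l` matrix `M` with entries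
in `𝓛` lies in a subspace `T` of `M_{d,l}` defined over `ℚ` all of whose members have rank
`≤ 2 · rank M` ("`M ∈ T ⊆ M_{d,l}(2r)`"). The printed induction on `d + l` is
`exists_isDefinedOverRat_two_mul_rank_of_linearSubgroup`; its input Theorem 1.2 is now a
theorem (`linearSubgroup_input`). [cite: Roy1995, §1 Corollary 1.3 (pp. 52–53)] -/
theorem exists_isDefinedOverRat_two_mul_rank (M : Matrix (Fin d) (Fin l) ℂ)
    (hM : ∀ i j, M i j ∈ logQSpan) :
    ∃ T : Submodule ℂ (Matrix (Fin d) (Fin l) ℂ),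
      IsDefinedOverRat T ∧ M ∈ T ∧ ∀ N ∈ T, N.rank ≤ 2 * M.rank :=
  exists_isDefinedOverRat_two_mul_rank_of_linearSubgroup linearSubgroup_input (d + l) d l rfl M hM

/-- **`s_str(M) ≤ 2 · rank M`** for every matrix with entries in `𝓛` (Roy 1995, Corollary 1.3 /
Remark (i)), unconditionally. [cite: Roy1995, §1 Remark (i) (p. 54)] -/
theorem structuralRank_le_two_mul_rank (M : Matrix (Fin d) (Fin l) ℂ)
    (hM : ∀ i j, M i j ∈ logQSpan) : structuralRank M ≤ 2 * M.rank :=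
  structuralRank_le_two_mul_rank_of_linearSubgroup linearSubgroup_input M hM

/-- **Discharge of the named fact `roy1995_structuralRank_le_two_mul_rank`** ("Corollary 1.3
shows that the rank `r` of `M` satisfies `r ≤ s ≤ 2r`", the non-trivial inequality): Roy's
deduction from Theorem 1.2 (`roy1995_structuralRank_le_two_mul_rank_of_linearSubgroup`) applied
to the discharged Theorem 1.2 (`linearSubgroup_input`).
[cite: Roy1995, §1 Corollary 1.3 and Remark (i) (p. 54)] -/
theorem roy1995_structuralRank_le_two_mul_rank_holds : roy1995_structuralRank_le_two_mul_rank :=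
  roy1995_structuralRank_le_two_mul_rank_of_linearSubgroup linearSubgroup_input

/-- **Roy's `r ≤ s ≤ 2r`**, as printed in Remark (i), unconditionally: the trivial half is
`rank_le_structuralRank`, the other half `structuralRank_le_two_mul_rank`.
[cite: Roy1995, §1 Remark (i) (p. 54)] -/
theorem rank_le_structuralRank_and_le_two_mul_rank (M : Matrix (Fin d) (Fin l) ℂ)
    (hM : ∀ i j, M i j ∈ logQSpan) :
    M.rank ≤ structuralRank M ∧ structuralRank M ≤ 2 * M.rank :=
  ⟨rank_le_structuralRank M, structuralRank_le_two_mul_rank M hM⟩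

/-- The same bound for a matrix whose entries are themselves logarithms of algebraic numbers
(`e^{M i j} ∈ ℚ̄`; such entries lie in `𝓛 = span_ℚ exp⁻¹(ℚ̄^×)`).
[cite: Roy1995, §1 Remark (i) (p. 54)] -/
theorem structuralRank_le_two_mul_rank_of_isAlgebraic_cexp (M : Matrix (Fin d) (Fin l) ℂ)
    (hM : ∀ i j, IsAlgebraic ℚ (cexp (M i j))) : structuralRank M ≤ 2 * M.rank :=
  structuralRank_le_two_mul_rank M fun i j => Submodule.subset_span (hM i j)

end Literature.Barriers.Schanuel

end
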